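import Summits.KontsevichZagierPeriods.KontsevichZagierPeriods.Theses.SymplecticScissors
import Literature.NumberTheory.Transcendental.AyoubPeriodSeries
import Literature.NumberTheory.Transcendental.AyoubPeriodSeriesPiAlgebraic
import Literature.NumberTheory.Transcendental.AyoubPeriodSeriesLocalizing
import Mathlib.RingTheory.MvPowerSeries.Rename
import Mathlib.RingTheory.PowerSeries.Binomial
import Summits.KontsevichZagierPeriods.KontsevichZagierPeriods.Theorems.SymplecticScissorsTypeAGenerationStubRestrCZero

/-!
# `TypeAGeneration` (stmt-KontsevichZagierPeriods-18392), line `Sketch`, stub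
`stub_binGermCalculus` (G2): formal calculus of the binomial germs `(1 − zᵢ/α)^a`

Registered stub `stub_binGermCalculus` of the crux `TypeAGeneration` (route SymplecticScissors,
line `Sketch`), on top of `Literature/NumberTheory/Transcendental/AyoubPeriodSeries.lean`
(`AyoubRel.CSeries = ℂ[[z₀, z₁, …]]`, `AyoubRel.pdz i = ∂/∂zᵢ`, `AyoubRel.restrC i 0 = (·)|_{zᵢ=0}`),
`…AyoubPeriodSeriesLocalizing.lean` (`AyoubRel.axisEmb i : Unit ↪ ℕ`, renaming a one-variable
series into the variable `zᵢ`) and Mathlib's `PowerSeries.binomialSeries ℂ a = (1 + X)^a`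
(coefficients `Ring.choose a n`).

The binomial germ `(1 − zᵢ/α)^a ∈ ℂ[[z]]` is `(1 + X)^a` rescaled by `X ↦ −α⁻¹ X`
(`PowerSeries.rescale`) and renamed into `zᵢ` (`MvPowerSeries.rename (axisEmb i)`). This file is
its **formal calculus** (no analysis, no hypothesis on `α`):

* coefficients: `C(a, n) (−α⁻¹)ⁿ` on the `zᵢ`-axis, `0` off it;
* the exponent law `(1 − zᵢ/α)^{a+b} = (1 − zᵢ/α)^a (1 − zᵢ/α)^b` (`binomialSeries_add` pushed
  through the two homomorphisms), the exponents `0` (`= 1`) and `1` (`= 1 − α⁻¹ zᵢ`);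
* the derivative `∂ᵢ (1 − zᵢ/α)^a = −(a/α) (1 − zᵢ/α)^{a−1}`, i.e. the absorption identity
  `(n + 1) C(a, n + 1) = a C(a − 1, n)` (from `descPochhammer ℤ (n+1) = X · (descPochhammer ℤ n)(X − 1)`
  and `(descPochhammer ℤ n)(r) = n! C(r, n)`);
* the face `(1 − zᵢ/α)^a |_{zᵢ=0} = C(a, 0) = 1`.

Elementary (folklore); no definition is introduced (the germ is a local notation).
-/

noncomputable section

-- `Summit.KontsevichZagierPeriods.KontsevichZagierPeriods.…` is the tree's mandated layout (single-conjunct summit).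
set_option linter.dupNamespace false

namespace Summit.KontsevichZagierPeriods.KontsevichZagierPeriods.TypeAGenerationLine

open Finsupp MvPowerSeries
open Literature.NumberTheory.Transcendental
open Literature.NumberTheory.Transcendental.AyoubRel

/-- The binomial germ `(1 − zᵢ/α)^a ∈ ℂ[[z]]`. -/
local notation3 "binGerm[" i ", " α ", " a "]" =>
  (MvPowerSeries.rename (⇑(axisEmb i))
    (PowerSeries.rescale (-(α : ℂ)⁻¹) (PowerSeries.binomialSeries ℂ (a : ℂ)) : MvPowerSeries Unit ℂ) :
    CSeries)

/-! ## The absorption identity for generalized binomial coefficients -/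

/-- **Absorption identity** `(n + 1) C(a, n + 1) = a C(a − 1, n)` in `ℂ`
(`(n+1)! C(a, n+1) = a (a−1) ⋯ (a−n) = a · n! C(a−1, n)`). [folklore] -/
theorem g2_succ_mul_choose (a : ℂ) (n : ℕ) :
    ((n : ℂ) + 1) * Ring.choose a (n + 1) = a * Ring.choose (a - 1) n := by
  have h1 := Ring.descPochhammer_eq_factorial_smul_choose a (n + 1)
  have h2 := Ring.descPochhammer_eq_factorial_smul_choose (a - 1) n
  rw [descPochhammer_succ_left, Polynomial.smeval_X_mul, Polynomial.smeval_comp,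
    Polynomial.smeval_sub, Polynomial.smeval_X, Polynomial.smeval_one, npow_one, npow_zero,
    one_smul, h2, Nat.factorial_succ, mul_smul, nsmul_eq_mul, nsmul_eq_mul, nsmul_eq_mul,
    Nat.cast_succ] at h1
  -- h1 : a * (n! * C(a-1, n)) = (n + 1) * (n! * C(a, n+1))
  have hn : (n.factorial : ℂ) ≠ 0 := Nat.cast_ne_zero.mpr (Nat.factorial_ne_zero n)
  apply mul_left_cancel₀ hn
  linear_combination -h1

/-! ## Coefficients of the binomial germ -/

/-- Coefficient of `zᵢⁿ` in `(1 − zᵢ/α)^a`: `C(a, n) (−α⁻¹)ⁿ`. [folklore] -/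
theorem g2_coeff_single (i : ℕ) (α a : ℂ) (n : ℕ) :
    coeff (single i n) (binGerm[i, α, a]) = Ring.choose a n * (-α⁻¹) ^ n := by
  -- adapted from `coeff_perGerm_single` (AyoubPeriodSeriesLocalizing.lean)
  have h := coeff_embDomain_rename (R := ℂ) (axisEmb i)
    (PowerSeries.rescale (-(α : ℂ)⁻¹) (PowerSeries.binomialSeries ℂ (a : ℂ)) :
      MvPowerSeries Unit ℂ) (single () n)
  rw [embDomain_single, axisEmb_apply] at h
  rw [h]
  change PowerSeries.coeff n (PowerSeries.rescale (-(α : ℂ)⁻¹) (PowerSeries.binomialSeries ℂ a)) = _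
  rw [PowerSeries.coeff_rescale, PowerSeries.binomialSeries_coeff, smul_eq_mul, mul_one, mul_comm]

/-- Off the `zᵢ`-axis the coefficients of `(1 − zᵢ/α)^a` vanish. [folklore] -/
theorem g2_coeff_of_ne (i : ℕ) (α a : ℂ) {x : ℕ →₀ ℕ} (hx : ∀ n, x ≠ single i n) :
    coeff x (binGerm[i, α, a]) = 0 := by
  -- adapted from `coeff_perGerm_of_ne` (AyoubPeriodSeriesLocalizing.lean)
  apply coeff_rename_eq_zero
  rintro ⟨y, hy⟩
  apply hx (y ())
  rw [← hy]
  conv_lhs => rw [unique_single y]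
  rw [mapDomain_single]
  rfl

/-- A multi-index `x` with `x + k eᵢ` on the `zᵢ`-axis is on the `zᵢ`-axis. [folklore] -/
theorem g2_eq_single_of_add_single {i k m : ℕ} {x : ℕ →₀ ℕ} (h : x + single i k = single i m) :
    x = single i (x i) := by
  ext j
  by_cases hj : j = i
  · rw [hj, single_eq_same]
  · have hxj := DFunLike.congr_fun h j
    rw [Finsupp.add_apply, single_eq_of_ne hj, single_eq_of_ne hj, add_zero] at hxj
    rw [single_eq_of_ne hj, hxj]

/-! ## Exponent law, exponents `0` and `1` -/

/-- **Exponent law** `(1 − zᵢ/α)^{a+b} = (1 − zᵢ/α)^a (1 − zᵢ/α)^b`. [folklore] -/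
theorem g2_binGerm_add (i : ℕ) (α a b : ℂ) :
    binGerm[i, α, a + b] = binGerm[i, α, a] * binGerm[i, α, b] := by
  rw [PowerSeries.binomialSeries_add, map_mul, map_mul]

/-- `(1 − zᵢ/α)^0 = 1`. [folklore] -/
theorem g2_binGerm_zero (i : ℕ) (α : ℂ) : binGerm[i, α, (0 : ℂ)] = 1 := by
  rw [PowerSeries.binomialSeries_zero, map_one, map_one]

/-- `(1 − zᵢ/α)^1 = 1 − α⁻¹ zᵢ`. [folklore] -/
theorem g2_binGerm_one (i : ℕ) (α : ℂ) : binGerm[i, α, (1 : ℂ)] = 1 - C α⁻¹ * X i := by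
  have h1 : PowerSeries.binomialSeries ℂ (1 : ℂ) = 1 + PowerSeries.X := by
    simpa using PowerSeries.binomialSeries_nat (R := ℂ) (A := ℂ) 1
  rw [h1, map_add, map_one, PowerSeries.rescale_X, map_add, map_one, map_mul]
  change 1 + MvPowerSeries.rename (axisEmb i) (MvPowerSeries.C (-α⁻¹) : MvPowerSeries Unit ℂ) *
    MvPowerSeries.rename (axisEmb i) (MvPowerSeries.X () : MvPowerSeries Unit ℂ) = (_ : CSeries)
  rw [rename_axisEmb_C, rename_axisEmb_X, map_neg, neg_mul, ← sub_eq_add_neg]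

/-! ## The derivative `∂ᵢ` and the face `zᵢ = 0` -/

/-- **`∂ᵢ (1 − zᵢ/α)^a = −(a/α) (1 − zᵢ/α)^{a−1}`** (coefficientwise: the absorption identity on the
`zᵢ`-axis, `0 = 0` off it). [folklore] -/
theorem g2_pdz_binGerm (i : ℕ) (α a : ℂ) :
    pdz i (binGerm[i, α, a]) = (-(a * α⁻¹)) • binGerm[i, α, a - 1] := by
  refine MvPowerSeries.ext fun x => ?_
  rw [StokesGenerationLine.coeff_pdz, coeff_smul]
  by_cases hx : ∃ n, x = single i n
  · obtain ⟨n, rfl⟩ := hx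
    rw [single_eq_same, ← single_add, g2_coeff_single, g2_coeff_single, pow_succ]
    linear_combination (-α⁻¹) ^ n * (-α⁻¹) * g2_succ_mul_choose a n
  · push Not at hx
    have hx' : ∀ m, x + single i 1 ≠ single i m := fun m hm =>
      hx (x i) (g2_eq_single_of_add_single hm)
    rw [g2_coeff_of_ne i α a hx', g2_coeff_of_ne i α (a - 1) hx, mul_zero, mul_zero]

/-- **`(1 − zᵢ/α)^a |_{zᵢ=0} = 1`** (the slice `aᵢ = 0` of a germ on the `zᵢ`-axis is its constant
coefficient `C(a, 0) = 1`). [folklore] -/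
theorem g2_restrC_zero_binGerm (i : ℕ) (α a : ℂ) : restrC i 0 (binGerm[i, α, a]) = 1 := by
  classical
  refine MvPowerSeries.ext fun x => ?_
  rw [s8_coeff_restrC_zero, coeff_one]
  by_cases hx0 : x = 0
  · subst hx0
    rw [Finsupp.coe_zero, Pi.zero_apply, if_pos rfl, if_pos rfl, ← single_zero i,
      g2_coeff_single, pow_zero, mul_one, Ring.choose_zero_right]
  · rw [if_neg hx0]
    split_ifs with hxi
    · refine g2_coeff_of_ne i α a fun n hn => hx0 ?_
      rw [hn, single_eq_same] at hxi
      rw [hn, hxi, single_zero]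
    · rfl

/-! ## Registered form -/

/-- **G2 — formal calculus of binomial germs.** Coefficients (`C(a,n) (−α⁻¹)ⁿ` on the `zᵢ`-axis,
`0` off it), the exponent law `(1−zᵢ/α)^{a+b} = (1−zᵢ/α)^a (1−zᵢ/α)^b`
(`PowerSeries.binomialSeries_add`), the exponents `0` and `1`, the derivative
`∂ᵢ (1−zᵢ/α)^a = −(a/α) (1−zᵢ/α)^{a−1}` (`(n+1) C(a,n+1) = a C(a−1,n)`) and the face
`(1−zᵢ/α)^a |_{zᵢ=0} = 1`. [folklore] -/
theorem stub_binGermCalculus :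
    ∀ (i : ℕ) (α : ℂ),
      (∀ (a : ℂ) (n : ℕ), MvPowerSeries.coeff (Finsupp.single i n) (binGerm[i, α, a]) =
        Ring.choose a n * (-α⁻¹) ^ n) ∧
      (∀ (a : ℂ) (x : ℕ →₀ ℕ), (∀ n : ℕ, x ≠ Finsupp.single i n) →
        MvPowerSeries.coeff x (binGerm[i, α, a]) = 0) ∧
      (∀ a b : ℂ, binGerm[i, α, a + b] = binGerm[i, α, a] * binGerm[i, α, b]) ∧
      binGerm[i, α, (0 : ℂ)] = 1 ∧
      binGerm[i, α, (1 : ℂ)] = 1 - C α⁻¹ * X i ∧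
      (∀ a : ℂ, pdz i (binGerm[i, α, a]) = (-(a * α⁻¹)) • binGerm[i, α, a - 1]) ∧
      (∀ a : ℂ, restrC i 0 (binGerm[i, α, a]) = 1) :=
  fun i α =>
    ⟨fun a n => g2_coeff_single i α a n, fun a _ hx => g2_coeff_of_ne i α a hx,
      fun a b => g2_binGerm_add i α a b, g2_binGerm_zero i α, g2_binGerm_one i α,
      fun a => g2_pdz_binGerm i α a, fun a => g2_restrC_zero_binGerm i α a⟩

end Summit.KontsevichZagierPeriods.KontsevichZagierPeriods.TypeAGenerationLine
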